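import Mathlib.NumberTheory.ModularForms.QExpansion
import Mathlib.NumberTheory.ModularForms.Derivative
import Mathlib.Analysis.Complex.LocallyUniformLimit
import HarnessLib

/-!
# The derivative `D = (2πi)⁻¹ d/dτ` on `q`-expansions: `D(Σ aₙqⁿ) = Σ n aₙ qⁿ`

For a function `f : ℍ → ℂ` which is `1`-periodic, holomorphic and bounded at `i∞` ("nice"; Mathlib's
`UpperHalfPlane.qExpansion 1 f` is then its convergent `q`-series, `hasSum_qExpansion`), the
normalised derivative `D f = (2πi)⁻¹ (f ∘ ofComplex)′` of Mathlib's `ModularForms/Derivative.lean`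
is again nice and its `q`-expansion is obtained coefficientwise: **`(D f)^∧(n) = n · f^∧(n)`**
(`qExpansion_D_coeff`), i.e. `D = q d/dq` on `q`-series (Zagier §5.1). Proof: termwise
differentiation of `Σ aₘ e^{2πimw}` on a half-plane `Im w > y₀`, where it converges normally
(`Complex.hasSum_deriv_of_summable_norm`).

* `hasSum_D` — `D f τ = Σ m aₘ qᵐ`;
* `periodic_D`, `isBoundedAtImInfty_D`, and (Mathlib) `normalizedDerivOfComplex_mdifferentiable`:
  `D f` is nice;
* `qExpansion_D_coeff`.

## References

* D. Zagier, *Elliptic modular forms and their applications* (2008), §5.1 (derivatives of modular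
  forms, `D = q d/dq`). [Zagier2008]
-/

noncomputable section

open UpperHalfPlane hiding I
open Complex Filter Topology Function Derivative
open scoped Real Manifold Topology

namespace Literature.NumberTheory.ModularForms

/-! ### Termwise differentiation of the `q`-series -/

/-- The terms `aₘ e^{2πimw}` of the `q`-series as entire functions of `w`. [folklore] -/
theorem hasDerivAt_qTerm (a : ℂ) (m : ℕ) (w : ℂ) :
    HasDerivAt (fun w : ℂ => a * cexp (2 * π * I * w) ^ m)
      (a * ((2 * π * I * m) * cexp (2 * π * I * w) ^ m)) w := by
  have h1 : HasDerivAt (fun w : ℂ => cexp (2 * π * I * w) ^ m)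
      ((m : ℕ) * cexp (2 * π * I * w) ^ (m - 1) * (cexp (2 * π * I * w) * (2 * π * I))) w := by
    have he : HasDerivAt (fun w : ℂ => cexp (2 * π * I * w)) (cexp (2 * π * I * w) * (2 * π * I)) w := by
      have := ((hasDerivAt_id w).const_mul (2 * π * I)).cexp
      simpa using this
    exact he.fun_pow m
  have h2 := h1.const_mul a
  refine h2.congr_deriv ?_
  rcases Nat.eq_zero_or_pos m with rfl | hm
  · simp
  · have hpow : cexp (2 * π * I * w) ^ m = cexp (2 * π * I * w) ^ (m - 1) * cexp (2 * π * I * w) := by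
      rw [← pow_succ, Nat.sub_add_cancel hm]
    rw [hpow]
    ring

/-- `‖e^{2πiw}‖ ≤ e^{−2πy₀}` on the half-plane `Im w ≥ y₀`. [folklore] -/
theorem norm_cexp_two_pi_I_le {w : ℂ} {y₀ : ℝ} (hw : y₀ ≤ w.im) :
    ‖cexp (2 * π * I * w)‖ ≤ Real.exp (-2 * π * y₀) := by
  rw [Complex.norm_exp]
  apply Real.exp_le_exp.mpr
  have : (2 * π * I * w).re = -2 * π * w.im := by
    have h1 : (2 * π * I * w : ℂ) = ((2 * π : ℝ) : ℂ) * (I * w) := by push_cast; ring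
    rw [h1, Complex.re_ofReal_mul, Complex.I_mul_re]
    ring
  rw [this]
  nlinarith [Real.pi_pos]

/-- **`D f τ = Σ m aₘ qᵐ`** for a `1`-periodic holomorphic `f` bounded at `i∞`, `aₘ` its
`q`-expansion coefficients, `q = e^{2πiτ}`. [cite: Zagier2008, §5.1] -/
theorem hasSum_D {f : ℍ → ℂ} (hper : Periodic (f ∘ ofComplex) 1) (hhol : MDiff f)
    (hbdd : IsBoundedAtImInfty f) (τ : ℍ) :
    HasSum (fun m : ℕ => ((m : ℂ) * (qExpansion 1 f).coeff m) • Periodic.qParam 1 (τ : ℂ) ^ m)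
      (D f τ) := by
  set a : ℕ → ℂ := fun m => (qExpansion 1 f).coeff m with ha
  -- the half-plane `U = {Im w > Im τ / 2}` and the bound `‖aₘ e^{2πimw}‖ ≤ ‖aₘ‖ rᵐ`
  set y₀ : ℝ := τ.im / 2 with hy₀
  have hy₀pos : 0 < y₀ := by rw [hy₀]; exact half_pos τ.im_pos
  set U : Set ℂ := {w : ℂ | y₀ < w.im} with hU
  have hUopen : IsOpen U := isOpen_lt continuous_const Complex.continuous_im
  have hτU : (τ : ℂ) ∈ U := by
    simp only [hU, Set.mem_setOf_eq, UpperHalfPlane.coe_im, hy₀]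
    linarith [τ.im_pos]
  set r : ℝ := Real.exp (-2 * π * y₀) with hr
  have hr0 : 0 ≤ r := (Real.exp_pos _).le
  have hr1 : r < 1 := by
    rw [hr, Real.exp_lt_one_iff]
    nlinarith [Real.pi_pos]
  -- summability of `‖aₘ‖ rᵐ` from the radius of convergence `≥ 1`
  have hsumm : Summable fun m : ℕ => ‖a m‖ * r ^ m := by
    letI : FiniteDimensional ℝ ℂ := Complex.basisOneI.finiteDimensional_of_finite
    have hq : ‖(r : ℂ)‖ < 1 := by
      rw [Complex.norm_real, Real.norm_of_nonneg hr0]; exact hr1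
    have hs := (hasSum_qExpansion_of_norm_lt one_pos hper hhol hbdd hq).summable.norm
    refine hs.congr fun m => ?_
    rw [ha, smul_eq_mul, norm_mul, norm_pow, Complex.norm_real, Real.norm_of_nonneg hr0]
  -- the terms, their differentiability and the uniform bound on `U`
  set F : ℕ → ℂ → ℂ := fun m w => a m * cexp (2 * π * I * w) ^ m with hF
  have hFdiff : ∀ m, DifferentiableOn ℂ (F m) U := fun m => by
    intro w _
    exact (hasDerivAt_qTerm (a m) m w).differentiableAt.differentiableWithinAt
  have hFle : ∀ (m : ℕ) (w : ℂ), w ∈ U → ‖F m w‖ ≤ ‖a m‖ * r ^ m := by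
    intro m w hw
    simp only [hF, norm_mul, norm_pow]
    gcongr
    exact norm_cexp_two_pi_I_le (le_of_lt hw)
  -- termwise differentiation
  have hD := Complex.hasSum_deriv_of_summable_norm hsumm hFdiff hUopen hFle hτU
  -- the sum is `f ∘ ofComplex` on `U`
  have hsumU : ∀ w ∈ U, HasSum (fun m => F m w) ((f ∘ ofComplex) w) := by
    intro w hw
    have hwpos : 0 < w.im := lt_trans hy₀pos hw
    have h := hasSum_qExpansion one_pos hper hhol hbdd ⟨w, hwpos⟩
    simp only [Function.comp_apply, ofComplex_apply_of_im_pos hwpos]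
    refine h.congr_fun fun m => ?_
    simp only [hF, ha, smul_eq_mul, Periodic.qParam, Complex.ofReal_one, div_one]
  have heq : (fun w : ℂ => ∑' m, F m w) =ᶠ[𝓝 (τ : ℂ)] (f ∘ ofComplex) := by
    filter_upwards [hUopen.mem_nhds hτU] with w hw
    exact (hsumU w hw).tsum_eq
  rw [heq.deriv_eq] at hD
  -- assemble `D f τ = (2πi)⁻¹ · deriv`
  have hDf : D f τ = (2 * π * I)⁻¹ * deriv (f ∘ ofComplex) τ := rfl
  rw [hDf]
  have hterm : ∀ m : ℕ, deriv (F m) (τ : ℂ) = a m * ((2 * π * I * m) * cexp (2 * π * I * τ) ^ m) :=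
    fun m => (hasDerivAt_qTerm (a m) m τ).deriv
  simp_rw [hterm] at hD
  have h2 := hD.mul_left ((2 * π * I)⁻¹)
  refine h2.congr_fun fun m => ?_
  have hπ : (2 * π * I : ℂ) ≠ 0 := by
    apply mul_ne_zero (mul_ne_zero two_ne_zero (ofReal_ne_zero.mpr Real.pi_ne_zero)) I_ne_zero
  simp only [smul_eq_mul, Periodic.qParam, Complex.ofReal_one, div_one]
  field_simp
  simp [ha]

/-! ### `D f` is nice -/

/-- `D f ∘ ofComplex` is `1`-periodic when `f ∘ ofComplex` is. [folklore] -/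
theorem periodic_D {f : ℍ → ℂ} (hper : Periodic (f ∘ ofComplex) 1) : Periodic (D f ∘ ofComplex) 1 := by
  -- the derivative of a periodic function is periodic
  have hdper : Periodic (deriv (f ∘ ofComplex)) 1 := by
    intro z
    have hfun : (f ∘ ofComplex) = fun x => (f ∘ ofComplex) (x + 1) := by
      funext x; exact (hper x).symm
    conv_rhs => rw [hfun]
    exact (deriv_comp_add_const (f := f ∘ ofComplex) (a := (1 : ℂ)) (x := z)).symm
  intro w
  by_cases hw : 0 < w.im
  · have hw1 : 0 < (w + 1).im := by simpa using hw
    have e1 : ((ofComplex (w + 1) : ℍ) : ℂ) = w + 1 := by rw [ofComplex_apply_of_im_pos hw1]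
    have e0 : ((ofComplex w : ℍ) : ℂ) = w := by rw [ofComplex_apply_of_im_pos hw]
    simp only [Function.comp_apply, normalizedDerivOfComplex, e1, e0, hdper w]
  · push Not at hw
    have hw1 : (w + 1).im ≤ 0 := by simpa using hw
    simp only [Function.comp_apply, ofComplex_apply_eq_of_im_nonpos hw1 hw]

/-- `D f` is bounded at `i∞`. [folklore] -/
theorem isBoundedAtImInfty_D {f : ℍ → ℂ} (hper : Periodic (f ∘ ofComplex) 1) (hhol : MDiff f)
    (hbdd : IsBoundedAtImInfty f) : IsBoundedAtImInfty (D f) :=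
  isBoundedAtImInfty_of_hasSum_qExpansion (h := 1) (f := D f)
    (c := fun m : ℕ => (m : ℂ) * (qExpansion 1 f).coeff m) one_pos (hasSum_D hper hhol hbdd)

/-- Coefficient uniqueness for plain functions (Mathlib's `qExpansion_coeff_unique` is stated for
bundled `FunLike` forms): if a nice `f` is everywhere the sum of `Σ cₘ qᵐ`, then `cₘ = f^∧(m)`.
[folklore] -/
theorem qExpansion_coeff_eq_of_hasSum {f : ℍ → ℂ} {c : ℕ → ℂ} (hper : Periodic (f ∘ ofComplex) 1)
    (hhol : MDiff f) (hbdd : IsBoundedAtImInfty f)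
    (hf : ∀ τ : ℍ, HasSum (fun m ↦ c m • Periodic.qParam 1 (τ : ℂ) ^ m) (f τ)) (n : ℕ) :
    (qExpansion 1 f).coeff n = c n := by
  have han : AnalyticAt ℂ (cuspFunction 1 f) 0 := analyticAt_cuspFunction_zero one_pos hper hhol hbdd
  have h1 : HasFPowerSeriesOnBall (cuspFunction 1 f) (.ofScalars ℂ c) 0 1 :=
    hasFPowerSeriesOnBall_cuspFunction one_pos han hf
  have h2 : HasFPowerSeriesOnBall (cuspFunction 1 f)
      (.ofScalars ℂ fun m => (qExpansion 1 f).coeff m) 0 1 :=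
    hasFPowerSeriesOnBall_cuspFunction one_pos han (hasSum_qExpansion one_pos hper hhol hbdd)
  have heq := h2.hasFPowerSeriesAt.eq_formalMultilinearSeries h1.hasFPowerSeriesAt
  have := congrArg (fun p : FormalMultilinearSeries ℂ ℂ ℂ => p.coeff n) heq
  simpa [FormalMultilinearSeries.coeff_ofScalars] using this

/-- **`(D f)^∧(n) = n · f^∧(n)`**: the `q`-expansion of `D f` is `q d/dq` of that of `f`.
[cite: Zagier2008, §5.1] -/
theorem qExpansion_D_coeff {f : ℍ → ℂ} (hper : Periodic (f ∘ ofComplex) 1) (hhol : MDiff f)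
    (hbdd : IsBoundedAtImInfty f) (n : ℕ) :
    (qExpansion 1 (D f)).coeff n = n * (qExpansion 1 f).coeff n :=
  qExpansion_coeff_eq_of_hasSum (periodic_D hper) (normalizedDerivOfComplex_mdifferentiable hhol)
    (isBoundedAtImInfty_D hper hhol hbdd) (hasSum_D hper hhol hbdd) n

/-! ### General period `h > 0` -/

/-- The terms `aₘ e^{2πimw/h}` and their derivatives. [folklore] -/
theorem hasDerivAt_qTerm_of_period {h : ℂ} (hh : h ≠ 0) (a : ℂ) (m : ℕ) (w : ℂ) :
    HasDerivAt (fun w : ℂ => a * cexp (2 * π * I * w / h) ^ m)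
      (a * ((2 * π * I * m / h) * cexp (2 * π * I * w / h) ^ m)) w := by
  have h1 : HasDerivAt (fun w : ℂ => cexp (2 * π * I * w / h) ^ m)
      ((m : ℕ) * cexp (2 * π * I * w / h) ^ (m - 1) *
        (cexp (2 * π * I * w / h) * (2 * π * I / h))) w := by
    have he : HasDerivAt (fun w : ℂ => cexp (2 * π * I * w / h))
        (cexp (2 * π * I * w / h) * (2 * π * I / h)) w := by
      have h0 := ((hasDerivAt_id w).const_mul (2 * π * I / h)).cexp
      have hfun : (fun w : ℂ => cexp (2 * π * I * w / h)) = fun w => cexp (2 * π * I / h * id w) := by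
        funext w; simp only [id]; ring_nf
      rw [hfun]
      refine h0.congr_deriv ?_
      simp only [id]
      ring_nf
    exact he.fun_pow m
  have h2 := h1.const_mul a
  refine h2.congr_deriv ?_
  rcases Nat.eq_zero_or_pos m with rfl | hm
  · simp
  · have hpow : cexp (2 * π * I * w / h) ^ m = cexp (2 * π * I * w / h) ^ (m - 1) * cexp (2 * π * I * w / h) := by
      rw [← pow_succ, Nat.sub_add_cancel hm]
    rw [hpow]
    field_simp

/-- `‖e^{2πiw/h}‖ ≤ e^{−2πy₀/h}` on the half-plane `Im w ≥ y₀` (`h > 0`). [folklore] -/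
theorem norm_cexp_two_pi_I_div_le {h : ℝ} (hh : 0 < h) {w : ℂ} {y₀ : ℝ} (hw : y₀ ≤ w.im) :
    ‖cexp (2 * π * I * w / h)‖ ≤ Real.exp (-2 * π * y₀ / h) := by
  rw [Complex.norm_exp]
  apply Real.exp_le_exp.mpr
  have : (2 * π * I * w / h).re = -2 * π * w.im / h := by
    have h1 : (2 * π * I * w / h : ℂ) = ((2 * π / h : ℝ) : ℂ) * (I * w) := by push_cast; ring
    rw [h1, Complex.re_ofReal_mul, Complex.I_mul_re]
    ring
  rw [this]
  have hπ := Real.pi_pos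
  rw [div_le_div_iff_of_pos_right hh]
  nlinarith

/-- **`D f τ = Σ (m/h) aₘ q_hᵐ`** for an `h`-periodic holomorphic `f` bounded at `i∞`, `aₘ` its
`q_h`-expansion coefficients, `q_h = e^{2πiτ/h}` (general period, e.g. the width of a cusp).
[cite: Zagier2008, §5.1] -/
theorem hasSum_D_of_period {h : ℝ} (hh : 0 < h) {f : ℍ → ℂ} (hper : Periodic (f ∘ ofComplex) h)
    (hhol : MDiff f) (hbdd : IsBoundedAtImInfty f) (τ : ℍ) :
    HasSum (fun m : ℕ => ((m : ℂ) / h * (qExpansion h f).coeff m) • Periodic.qParam h (τ : ℂ) ^ m)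
      (D f τ) := by
  set a : ℕ → ℂ := fun m => (qExpansion h f).coeff m with ha
  have hh0 : (h : ℂ) ≠ 0 := ofReal_ne_zero.mpr hh.ne'
  -- the half-plane `U = {Im w > Im τ / 2}` and the bound `‖aₘ e^{2πimw}‖ ≤ ‖aₘ‖ rᵐ`
  set y₀ : ℝ := τ.im / 2 with hy₀
  have hy₀pos : 0 < y₀ := by rw [hy₀]; exact half_pos τ.im_pos
  set U : Set ℂ := {w : ℂ | y₀ < w.im} with hU
  have hUopen : IsOpen U := isOpen_lt continuous_const Complex.continuous_im
  have hτU : (τ : ℂ) ∈ U := by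
    simp only [hU, Set.mem_setOf_eq, UpperHalfPlane.coe_im, hy₀]
    linarith [τ.im_pos]
  set r : ℝ := Real.exp (-2 * π * y₀ / h) with hr
  have hr0 : 0 ≤ r := (Real.exp_pos _).le
  have hr1 : r < 1 := by
    rw [hr, Real.exp_lt_one_iff, div_neg_iff]
    right
    exact ⟨by nlinarith [Real.pi_pos], hh⟩
  -- summability of `‖aₘ‖ rᵐ` from the radius of convergence `≥ 1`
  have hsumm : Summable fun m : ℕ => ‖a m‖ * r ^ m := by
    letI : FiniteDimensional ℝ ℂ := Complex.basisOneI.finiteDimensional_of_finite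
    have hq : ‖(r : ℂ)‖ < 1 := by
      rw [Complex.norm_real, Real.norm_of_nonneg hr0]; exact hr1
    have hs := (hasSum_qExpansion_of_norm_lt hh hper hhol hbdd hq).summable.norm
    refine hs.congr fun m => ?_
    rw [ha, smul_eq_mul, norm_mul, norm_pow, Complex.norm_real, Real.norm_of_nonneg hr0]
  -- the terms, their differentiability and the uniform bound on `U`
  set F : ℕ → ℂ → ℂ := fun m w => a m * cexp (2 * π * I * w / h) ^ m with hF
  have hFdiff : ∀ m, DifferentiableOn ℂ (F m) U := fun m => by
    intro w _
    exact (hasDerivAt_qTerm_of_period hh0 (a m) m w).differentiableAt.differentiableWithinAt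
  have hFle : ∀ (m : ℕ) (w : ℂ), w ∈ U → ‖F m w‖ ≤ ‖a m‖ * r ^ m := by
    intro m w hw
    simp only [hF, norm_mul, norm_pow]
    gcongr
    exact norm_cexp_two_pi_I_div_le hh (le_of_lt hw)
  -- termwise differentiation
  have hD := Complex.hasSum_deriv_of_summable_norm hsumm hFdiff hUopen hFle hτU
  -- the sum is `f ∘ ofComplex` on `U`
  have hsumU : ∀ w ∈ U, HasSum (fun m => F m w) ((f ∘ ofComplex) w) := by
    intro w hw
    have hwpos : 0 < w.im := lt_trans hy₀pos hw
    have h' := hasSum_qExpansion hh hper hhol hbdd ⟨w, hwpos⟩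
    simp only [Function.comp_apply, ofComplex_apply_of_im_pos hwpos]
    refine h'.congr_fun fun m => ?_
    simp only [hF, ha, smul_eq_mul, Periodic.qParam]
  have heq : (fun w : ℂ => ∑' m, F m w) =ᶠ[𝓝 (τ : ℂ)] (f ∘ ofComplex) := by
    filter_upwards [hUopen.mem_nhds hτU] with w hw
    exact (hsumU w hw).tsum_eq
  rw [heq.deriv_eq] at hD
  -- assemble `D f τ = (2πi)⁻¹ · deriv`
  have hDf : D f τ = (2 * π * I)⁻¹ * deriv (f ∘ ofComplex) τ := rfl
  rw [hDf]
  have hterm : ∀ m : ℕ, deriv (F m) (τ : ℂ) = a m * ((2 * π * I * m / h) * cexp (2 * π * I * τ / h) ^ m) :=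
    fun m => (hasDerivAt_qTerm_of_period hh0 (a m) m τ).deriv
  simp_rw [hterm] at hD
  have h2 := hD.mul_left ((2 * π * I)⁻¹)
  refine h2.congr_fun fun m => ?_
  have hπ : (2 * π * I : ℂ) ≠ 0 := by
    apply mul_ne_zero (mul_ne_zero two_ne_zero (ofReal_ne_zero.mpr Real.pi_ne_zero)) I_ne_zero
  simp only [smul_eq_mul, Periodic.qParam]
  field_simp
  simp [ha]

/-! ### `D f` is nice -/

/-- `D f ∘ ofComplex` is `h`-periodic when `f ∘ ofComplex` is. [folklore] -/
theorem periodic_D_of_period {h : ℝ} {f : ℍ → ℂ} (hper : Periodic (f ∘ ofComplex) h) :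
    Periodic (D f ∘ ofComplex) h := by
  -- the derivative of a periodic function is periodic
  have hdper : Periodic (deriv (f ∘ ofComplex)) h := by
    intro z
    have hfun : (f ∘ ofComplex) = fun x => (f ∘ ofComplex) (x + h) := by
      funext x; exact (hper x).symm
    conv_rhs => rw [hfun]
    exact (deriv_comp_add_const (f := f ∘ ofComplex) (a := (h : ℂ)) (x := z)).symm
  intro w
  by_cases hw : 0 < w.im
  · have hw1 : 0 < (w + h).im := by simpa using hw
    have e1 : ((ofComplex (w + h) : ℍ) : ℂ) = w + h := by rw [ofComplex_apply_of_im_pos hw1]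
    have e0 : ((ofComplex w : ℍ) : ℂ) = w := by rw [ofComplex_apply_of_im_pos hw]
    simp only [Function.comp_apply, normalizedDerivOfComplex, e1, e0, hdper w]
  · push Not at hw
    have hw1 : (w + h).im ≤ 0 := by simpa using hw
    simp only [Function.comp_apply, ofComplex_apply_eq_of_im_nonpos hw1 hw]

/-- `D f` is bounded at `i∞` (period `h`). [folklore] -/
theorem isBoundedAtImInfty_D_of_period {h : ℝ} (hh : 0 < h) {f : ℍ → ℂ}
    (hper : Periodic (f ∘ ofComplex) h) (hhol : MDiff f) (hbdd : IsBoundedAtImInfty f) :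
    IsBoundedAtImInfty (D f) :=
  isBoundedAtImInfty_of_hasSum_qExpansion (h := h) (f := D f)
    (c := fun m : ℕ => (m : ℂ) / h * (qExpansion h f).coeff m) hh (hasSum_D_of_period hh hper hhol hbdd)

/-- Coefficient uniqueness for plain functions, period `h`. [folklore] -/
theorem qExpansion_coeff_eq_of_hasSum_of_period {h : ℝ} (hh : 0 < h) {f : ℍ → ℂ} {c : ℕ → ℂ}
    (hper : Periodic (f ∘ ofComplex) h) (hhol : MDiff f) (hbdd : IsBoundedAtImInfty f)
    (hf : ∀ τ : ℍ, HasSum (fun m ↦ c m • Periodic.qParam h (τ : ℂ) ^ m) (f τ)) (n : ℕ) :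
    (qExpansion h f).coeff n = c n := by
  have han : AnalyticAt ℂ (cuspFunction h f) 0 := analyticAt_cuspFunction_zero hh hper hhol hbdd
  have h1 : HasFPowerSeriesOnBall (cuspFunction h f) (.ofScalars ℂ c) 0 1 :=
    hasFPowerSeriesOnBall_cuspFunction hh han hf
  have h2 : HasFPowerSeriesOnBall (cuspFunction h f)
      (.ofScalars ℂ fun m => (qExpansion h f).coeff m) 0 1 :=
    hasFPowerSeriesOnBall_cuspFunction hh han (hasSum_qExpansion hh hper hhol hbdd)
  have heq := h2.hasFPowerSeriesAt.eq_formalMultilinearSeries h1.hasFPowerSeriesAt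
  have := congrArg (fun p : FormalMultilinearSeries ℂ ℂ ℂ => p.coeff n) heq
  simpa [FormalMultilinearSeries.coeff_ofScalars] using this

/-- **`(D f)^∧(n) = (n/h) · f^∧(n)`** for period `h`: `D = (1/h) q_h d/dq_h`. [cite: Zagier2008, §5.1] -/
theorem qExpansion_D_coeff_of_period {h : ℝ} (hh : 0 < h) {f : ℍ → ℂ}
    (hper : Periodic (f ∘ ofComplex) h) (hhol : MDiff f) (hbdd : IsBoundedAtImInfty f) (n : ℕ) :
    (qExpansion h (D f)).coeff n = n / h * (qExpansion h f).coeff n :=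
  qExpansion_coeff_eq_of_hasSum_of_period hh (periodic_D_of_period hper)
    (normalizedDerivOfComplex_mdifferentiable hhol) (isBoundedAtImInfty_D_of_period hh hper hhol hbdd)
    (hasSum_D_of_period hh hper hhol hbdd) n

end Literature.NumberTheory.ModularForms

end
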